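import Summits.ResolutionOfSingularities.ResolutionOfSingularities.Theorems.ConeExit.Negative.Mirror
import HarnessLib

/-!
# `WildCones.ConeExit` (stmt-ResolutionOfSingularities-16883), line `critical-plane`: stub `stub_faceToPlane`

SERIES ↔ POLYNOMIAL TRANSFER on a formal 2-plane. Let `c'` be a state whose CLEANED coefficients
on the face `{Bᵢ = 0}` are the cleaned coefficients of a polynomial `P` (hypothesis `hface`), and
let `a m := C (ĉ m) * X 0 + C (ℓ m) * X 1 ∈ K[[X₀, X₁]]` be a formal plane with `ĉ i = ℓ i = 0`
(so `a i = 0` and every `a m` has zero constant coefficient, whence `MvPowerSeries.HasSubst a`).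
Then

* for `k ≠ i`, substituting the plane into `∂_k (ser p c')` gives the polynomial `∂_k P` on the
  plane: `subst a (pd k (ser p c')) = ↑(aeval a_poly (pderiv k P))`;
* the constant term of `subst a (pd i (ser p c'))` is `algebraMap κ K (clean p c' eᵢ)`.

Proof. (a) Coefficients: `coeff A (pd k (ser p c')) = (A k + 1) * clean p c' (A + e_k)`
(`coeff_pd_ser`, `coeff_ser`) and `coeff A (pderiv k P) = coeff (A + e_k) P * (A k + 1)`
(`MvPolynomial.coeff_pderiv`). (b) For `k ≠ i` and `A i = 0`, `B := A + e_k` lies on the face, so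
`hface` applies; if all `p ∣ B j` then `p ∣ A k + 1` and the factor `(A k + 1 : κ)` vanishes
(`CharP`), so both coefficients vanish; otherwise they agree. Hence every coefficient of
`D := pd k (ser p c') - ↑(pderiv k P)` off `X i` vanishes, i.e. `X i ∣ D`
(`MvPowerSeries.X_dvd_iff`). (c) `subst a` is a ring map killing `X i` (`a i = 0`), so
`subst a (pd k (ser p c')) = subst a ↑(pderiv k P) = aeval a (pderiv k P)` (`subst_coe`), and
`aeval (↑ ∘ a_poly) q = ↑(aeval a_poly q)` since the coercion `K[X₀,X₁] → K[[X₀,X₁]]` is a ring map.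
(d) Constant term: split `f := pd i (ser p c')` as `C c₀ + (f - C c₀)` with `c₀ = constantCoeff f
= clean p c' eᵢ`; the `κ`-algebra map `subst a` sends `C c₀` to `C (algebraMap κ K c₀)` and the
second summand to a series without constant term (`constantCoeff_subst_eq_zero`).

Sources: Mathlib's `MvPowerSeries.Substitution` API (Bourbaki, Algèbre II, chap. 4, §4, n° 3);
the statement itself is bookkeeping for the line `critical-plane` [folklore].
-/

noncomputable section

-- single-problem summit: the doubled namespace component `ResolutionOfSingularities` is forced
set_option linter.dupNamespace false

open Summit.ResolutionOfSingularities.ResolutionOfSingularities.Theorems.ConeExit.Negative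
  (clean bl ord dv tr step ser pd jac cone Linv dL)
open Summit.ResolutionOfSingularities.ResolutionOfSingularities.Theorems.ConeExit.Negative
  (coeff_ser coeff_pd_ser)
open scoped BigOperators

namespace Summit.ResolutionOfSingularities.ResolutionOfSingularities.Theorems.WildConesConeExit

/-- **Face comparison.** If the cleaned coefficients of `c'` on the face `{Bᵢ = 0}` are the cleaned
coefficients of `P`, then for `k ≠ i` the difference `∂_k (ser p c') - ∂_k P` is divisible by `X i`:
on the face the two coefficient formulas agree, the `p`-divisible row being killed on both sides by
the factor `A k + 1 ≡ 0 (mod p)`. [folklore] -/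
theorem facePlane_X_dvd {n : ℕ} {κ : Type} [Field κ] (p : ℕ) [CharP κ p]
    (c' : (Fin n → ℕ) → κ) (i : Fin n) (P : MvPolynomial (Fin n) κ)
    (hface : ∀ B : Fin n → ℕ, B i = 0 → clean p c' B =
      if (∀ j, p ∣ B j) then 0 else MvPolynomial.coeff (Finsupp.equivFunOnFinite.symm B) P)
    (k : Fin n) (hk : k ≠ i) :
    (MvPowerSeries.X i : MvPowerSeries (Fin n) κ) ∣
      pd k (ser p c') - (MvPolynomial.pderiv k P : MvPowerSeries (Fin n) κ) := by
  rw [MvPowerSeries.X_dvd_iff]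
  intro m hmi
  have hBi : (m + Finsupp.single k 1 : Fin n →₀ ℕ) i = 0 := by
    rw [Finsupp.coe_add, Pi.add_apply, hmi, Finsupp.single_eq_of_ne' hk, add_zero]
  have hcl := hface _ hBi
  rw [Finsupp.equivFunOnFinite_symm_coe] at hcl
  rw [map_sub, coeff_pd_ser, coeff_ser, MvPolynomial.coeff_coe, MvPolynomial.coeff_pderiv, hcl]
  by_cases hdiv : ∀ j, p ∣ (m + Finsupp.single k 1 : Fin n →₀ ℕ) j
  · have hk0 : ((m k + 1 : ℕ) : κ) = 0 := by
      rw [CharP.cast_eq_zero_iff κ p]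
      simpa [Finsupp.coe_add, Finsupp.single_eq_same] using hdiv k
    have hk0' : ((m k : κ) + 1) = 0 := by
      rw [← Nat.cast_succ]
      exact hk0
    rw [if_pos hdiv, mul_zero, zero_sub, neg_eq_zero, hk0', mul_zero]
  · rw [if_neg hdiv]
    push_cast
    ring

/-- **Transfer for `k ≠ i`.** Along any substitution `a` with `HasSubst a` and `a i = 0`, the image
of `∂_k (ser p c')` is the (polynomial) evaluation of `∂_k P` at `a`. [folklore] -/
theorem facePlane_subst_pd_of_ne {n : ℕ} {κ : Type} [Field κ] {K : Type} [Field K] [Algebra κ K]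
    (p : ℕ) [CharP κ p] (c' : (Fin n → ℕ) → κ) (i : Fin n) (P : MvPolynomial (Fin n) κ)
    (hface : ∀ B : Fin n → ℕ, B i = 0 → clean p c' B =
      if (∀ j, p ∣ B j) then 0 else MvPolynomial.coeff (Finsupp.equivFunOnFinite.symm B) P)
    {a : Fin n → MvPowerSeries (Fin 2) K} (ha : MvPowerSeries.HasSubst a) (hai : a i = 0)
    (k : Fin n) (hk : k ≠ i) :
    MvPowerSeries.subst a (pd k (ser p c')) =
      MvPolynomial.aeval a (MvPolynomial.pderiv k P) := by
  obtain ⟨R, hR⟩ := facePlane_X_dvd p c' i P hface k hk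
  have h1 : MvPowerSeries.subst a (pd k (ser p c')) =
      MvPowerSeries.subst a (MvPolynomial.pderiv k P : MvPowerSeries (Fin n) κ) := by
    rw [← sub_eq_zero, ← MvPowerSeries.subst_sub ha, hR, MvPowerSeries.subst_mul ha,
      MvPowerSeries.subst_X ha, hai, zero_mul]
  rw [h1, MvPowerSeries.subst_coe]

/-- **Polynomial substitutions commute with the coercion to power series.** For a polynomial family
`b`, evaluating `q` at `↑ ∘ b` inside `K[[X₀, X₁]]` is the coercion of the polynomial `aeval b q`
(the coercion `K[X₀,X₁] → K[[X₀,X₁]]` is a ring map compatible with constants). [folklore] -/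
theorem facePlane_aeval_coe {n : ℕ} {κ : Type} [Field κ] {K : Type} [Field K] [Algebra κ K]
    (b : Fin n → MvPolynomial (Fin 2) K) (q : MvPolynomial (Fin n) κ) :
    MvPolynomial.aeval (fun m => (b m : MvPowerSeries (Fin 2) K)) q =
      ((MvPolynomial.aeval b q : MvPolynomial (Fin 2) K) : MvPowerSeries (Fin 2) K) := by
  induction q using MvPolynomial.induction_on with
  | C r =>
    rw [MvPolynomial.aeval_C, MvPolynomial.aeval_C, MvPowerSeries.algebraMap_apply,
      MvPolynomial.algebraMap_apply, MvPolynomial.coe_C]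
  | add f g hf hg => rw [map_add, map_add, hf, hg, MvPolynomial.coe_add]
  | mul_X f m hf =>
    rw [map_mul, map_mul, MvPolynomial.aeval_X, MvPolynomial.aeval_X, hf, MvPolynomial.coe_mul]

/-- **Constant term of the image of `∂ᵢ`.** Along any substitution `a` by series without constant
terms, the constant coefficient of `subst a (pd i (ser p c'))` is `algebraMap κ K (clean p c' eᵢ)`:
`subst a` is a `κ`-algebra map, so it sends `C c₀` to `C (algebraMap κ K c₀)`, and it sends series
without constant term to series without constant term. [folklore] -/
theorem facePlane_constantCoeff_subst_pd {n : ℕ} {κ : Type} [Field κ] {K : Type} [Field K]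
    [Algebra κ K] (p : ℕ) (c' : (Fin n → ℕ) → κ) (i : Fin n)
    {a : Fin n → MvPowerSeries (Fin 2) K} (ha' : ∀ m, MvPowerSeries.constantCoeff (a m) = 0) :
    MvPowerSeries.constantCoeff (MvPowerSeries.subst a (pd i (ser p c'))) =
      algebraMap κ K (clean p c' (Pi.single i 1)) := by
  have ha : MvPowerSeries.HasSubst a := MvPowerSeries.hasSubst_of_constantCoeff_zero ha'
  set f : MvPowerSeries (Fin n) κ := pd i (ser p c') with hf
  have hc0 : MvPowerSeries.constantCoeff f = clean p c' (Pi.single i 1) := by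
    rw [hf, ← MvPowerSeries.coeff_zero_eq_constantCoeff_apply, coeff_pd_ser, coeff_ser]
    simp [Finsupp.single_eq_pi_single]
  have hsplit : f = MvPowerSeries.C (MvPowerSeries.constantCoeff f) +
      (f - MvPowerSeries.C (MvPowerSeries.constantCoeff f)) := by ring
  have hf' : MvPowerSeries.constantCoeff
      (f - MvPowerSeries.C (MvPowerSeries.constantCoeff f)) = 0 := by
    rw [map_sub, MvPowerSeries.constantCoeff_C, sub_self]
  rw [hsplit, MvPowerSeries.subst_add ha, map_add,
    MvPowerSeries.constantCoeff_subst_eq_zero ha ha' hf', add_zero,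
    ← MvPowerSeries.coe_substAlgHom ha, MvPowerSeries.c_eq_algebraMap, AlgHom.commutes,
    MvPowerSeries.algebraMap_apply, MvPowerSeries.constantCoeff_C, hc0]

/-- **Face-to-plane transfer** (series ↔ polynomial): if the cleaned coefficients of a state `c'` on
the face `{Bᵢ = 0}` are the cleaned coefficients of a polynomial `P`, then along any formal plane
`a m = C (ĉ m) * X 0 + C (ℓ m) * X 1` inside `{vᵢ = 0}` (`ĉ i = ℓ i = 0`) the image of `∂_k c'`
(`k ≠ i`) is the polynomial `∂_k P` on the plane, and the image of `∂ᵢ c'` has constant term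
`c'(eᵢ)`. [folklore] -/
theorem stub_faceToPlane : ∀ (p : ℕ), p.Prime → ∀ (n : ℕ) (κ : Type) [Field κ] [CharP κ p] (c' : (Fin n → ℕ) → κ) (i : Fin n) (P : MvPolynomial (Fin n) κ) (K : Type) [Field K] [Algebra κ K] (ĉ ℓ : Fin n → K), ĉ i = 0 → ℓ i = 0 → (∀ B : Fin n → ℕ, B i = 0 → clean p c' B = if (∀ j, p ∣ B j) then 0 else MvPolynomial.coeff (Finsupp.equivFunOnFinite.symm B) P) → (∀ k : Fin n, k ≠ i → MvPowerSeries.subst (fun m : Fin n => MvPowerSeries.C (ĉ m) * MvPowerSeries.X (0 : Fin 2) + MvPowerSeries.C (ℓ m) * MvPowerSeries.X 1) (pd k (ser p c')) = ((MvPolynomial.aeval (fun m : Fin n => MvPolynomial.C (ĉ m) * MvPolynomial.X (0 : Fin 2) + MvPolynomial.C (ℓ m) * MvPolynomial.X 1) (MvPolynomial.pderiv k P) : MvPolynomial (Fin 2) K) : MvPowerSeries (Fin 2) K)) ∧ MvPowerSeries.constantCoeff (MvPowerSeries.subst (fun m : Fin n => MvPowerSeries.C (ĉ m) * MvPowerSeries.X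 (0 : Fin 2) + MvPowerSeries.C (ℓ m) * MvPowerSeries.X 1) (pd i (ser p c'))) = algebraMap κ K (clean p c' (Pi.single i 1)) := by
  intro p _ n κ _ _ c' i P K _ _ ĉ ℓ hĉ hℓ hface
  have ha' : ∀ m : Fin n, MvPowerSeries.constantCoeff
      ((fun m : Fin n => MvPowerSeries.C (ĉ m) * MvPowerSeries.X (0 : Fin 2) +
        MvPowerSeries.C (ℓ m) * MvPowerSeries.X 1 : Fin n → MvPowerSeries (Fin 2) K) m) = 0 := by
    intro m
    simp
  have ha : MvPowerSeries.HasSubst (fun m : Fin n => MvPowerSeries.C (ĉ m) *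
      MvPowerSeries.X (0 : Fin 2) + MvPowerSeries.C (ℓ m) * MvPowerSeries.X 1 :
        Fin n → MvPowerSeries (Fin 2) K) :=
    MvPowerSeries.hasSubst_of_constantCoeff_zero ha'
  have hai : (fun m : Fin n => MvPowerSeries.C (ĉ m) * MvPowerSeries.X (0 : Fin 2) +
      MvPowerSeries.C (ℓ m) * MvPowerSeries.X 1 : Fin n → MvPowerSeries (Fin 2) K) i = 0 := by
    simp [hĉ, hℓ]
  refine ⟨fun k hk => ?_, facePlane_constantCoeff_subst_pd p c' i ha'⟩
  rw [facePlane_subst_pd_of_ne p c' i P hface ha hai k hk, ← facePlane_aeval_coe]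
  simp only [MvPolynomial.coe_add, MvPolynomial.coe_mul, MvPolynomial.coe_C, MvPolynomial.coe_X]

end Summit.ResolutionOfSingularities.ResolutionOfSingularities.Theorems.WildConesConeExit

end
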